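import Literature.NumberTheory.DiophantineApproximation.PolylogHermitePadeForms
import Literature.NumberTheory.DiophantineApproximation.PolylogHermitePadeSeries
import Literature.NumberTheory.DiophantineApproximation.PolylogHermitePadeBounds
import Literature.NumberTheory.DiophantineApproximation.FactorialPowerRate
import Literature.NumberTheory.DiophantineApproximation.SmallFormsIndependence
import Literature.NumberTheory.DiophantineApproximation.IntegerFormsTransference
import HarnessLib

/-!
# Linear independence of `1, Li₁(1/N), …, Li_w(1/N)` over `ℚ` for `log N ≥ (w+1)³`

Topic `Literature/NumberTheory/DiophantineApproximation`. For every weight `w ≥ 1` and every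
integer `N` with `log N ≥ (w + 1)³`, the `w + 1` real numbers

  `1`,  `L_s = ∑_{k≥1} N^{-k}/k^s = Li_s(1/N)`  (`1 ≤ s ≤ w`)

are linearly independent over `ℚ` (`PolylogPade.intRelation_trivial`, integer coefficients;
`one_polylog_linearIndependent`, rational coefficients). This is the theorem of Nikišin (1979) and
Hata (1990) on polylogarithms at `1/N`, in the form of David–Hirata-Kohno–Kawashima 2020, Thm 2.1,
with a crude threshold (`N₀(w) = e^{(w+1)³}`; no attempt at optimality).
-- TODO(general form): algebraic points and the thresholds of [DavidHirataKohnoKawashima2020, Thm 2.1].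

## Proof (assembled from the sibling files)

The type-I Hermite–Padé kernel `R^{(w)}_n(u) = (u − wn + 1)_{wn}/(u+1)_{n+1}^w` is the product of
Rivoal's bricks `F_1 ⋯ F_w`, so (`PolylogHermitePadeExpansion.lean`, over the tree's
`BallRivoal.exists_pf_prod`) it expands as `∑ c_{o,p}/(u+p+1)^{o+1}` with `d_n^{w−1−o} c_{o,p} ∈ ℤ`
and `∑|c| ≤ w!·2^{O(w²) n}`; the form `S_n = ∑_u R(u) N^{−u−1}` is then
`∑_{o<w} a_o L_{o+1} + a` (`PolylogHermitePadeSeries.lean`) with `d_n^w a_o, d_n^w a ∈ ℤ`,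
`|a_o| ≤ (∑|c|) N^n` (`PolylogHermitePadeForms.lean`), and
`(wn)!^{w+1}/((w+1)n+1)!^w · N^{−wn−1} ≤ S_n ≤ N^{−wn}` (`PolylogHermitePadeBounds.lean`). With
`d_n^w ≤ e^{(w+ε)n}` (prime number theorem) and `(wn)!^{w+1}/((w+1)n+1)!^w ≥ e^{−(κ_w+ε)n}`,
`κ_w = w(w+1) log(1+1/w) ≤ w + 1` (`FactorialPowerRate.lean`), the INTEGER forms
`ℓ_n = d_n^w S_n` have rates `A₂ = w log N − w − ε`, `A₁ = w log N + κ_w + ε`,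
`B = log N + w(w+2) log 2 + w + ε`. A nontrivial relation among `1, L₁, …, L_w` would, by the
reduction `relation_trivial_of_small_forms` (`SmallFormsIndependence.lean`) and the
`(w−1)`-dimensional two-rate transference lemma `no_integer_forms`
(`IntegerFormsTransference.lean`), require `(w−1) B ≥ A₂` or `(w−1)(A₁ + B) ≥ w A₂`; both fail as
soon as `log N > (w−1)(κ_w + w(w+2) log 2 + w) + w² + O(ε)`, which `log N ≥ (w+1)³` guarantees.

References: E. M. Nikišin, Mat. Sb. 109 (1979); M. Hata, J. Math. Pures Appl. 69 (1990);
S. David, N. Hirata-Kohno, M. Kawashima, Moscow J. Comb. Number Th. 9 (2020), Thm 2.1;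
Yu. V. Nesterenko, Vestnik MGU (1985) (the criterion).
-/

noncomputable section

open Finset Filter Real

namespace Literature.NumberTheory.DiophantineApproximation

namespace PolylogPade

open _root_.Filter _root_.Topology
open Literature.NumberTheory.Transcendental

/-- The numerical heart of the threshold `log N ≥ (w+1)³`: with `κ ≤ w + 1` and
`c_w ≤ 0.7·w(w+2)` the two gap conditions of the reduction/transference lemmas hold for the rates
`A₁ = wL + κ + 2δ`, `A₂ = wL − w − δ`, `B = L + c_w + w + 2δ`, `δ = 1/8`. [folklore] -/
theorem gap_inequalities {wr L κ cw δ : ℝ} (hwr1 : 1 ≤ wr) (hδ : δ = 1 / 8) (hκ0 : 0 ≤ κ)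
    (hκ1 : κ ≤ wr + 1) (hcw0 : 0 ≤ cw) (hcw1 : cw ≤ 0.7 * wr * (wr + 2)) (hL : (wr + 1) ^ 3 ≤ L) :
    0 < wr * L - wr - δ ∧
      (wr - 1) * (L + cw + wr + 2 * δ) < wr * L - wr - δ ∧
        (wr - 1) * ((wr * L + κ + 2 * δ) + (L + cw + wr + 2 * δ)) <
          (wr - 1 + 1) * (wr * L - wr - δ) := by
  have hw0 : (0 : ℝ) ≤ wr - 1 := by linarith
  have h1 := mul_le_mul_of_nonneg_left hκ1 hw0
  have h2 := mul_le_mul_of_nonneg_left hcw1 hw0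
  have h3 := mul_nonneg hw0 hκ0
  have h4 := mul_nonneg hw0 hcw0
  have hL8 : 8 ≤ L := le_trans (by nlinarith) hL
  subst hδ
  refine ⟨by nlinarith, ?_, ?_⟩
  · nlinarith [sq_nonneg (wr - 1), mul_nonneg hw0 (sq_nonneg wr), mul_nonneg hw0 (by linarith : (0:ℝ) ≤ L - 8)]
  · nlinarith [sq_nonneg (wr - 1), mul_nonneg hw0 (sq_nonneg wr), mul_nonneg hw0 (by linarith : (0:ℝ) ≤ L - 8)]

/-- **No integer relation among `1, Li₁(1/N), …, Li_w(1/N)`** for `w ≥ 1` and `log N ≥ (w+1)³`: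
if `c₀ + ∑_{j<w} c_{j+1} L_{j+1} = 0` with integers `c_j` (`L_s = DilogPade.polylogSeries s (1/N)`),
then all `c_j = 0`. [cite: DavidHirataKohnoKawashima2020, Thm 2.1] -/
theorem intRelation_trivial (w : ℕ) (hw : 1 ≤ w) (N : ℕ) (hN : ((w : ℝ) + 1) ^ 3 ≤ Real.log N)
    (c : Fin (w + 1) → ℤ)
    (h : (c 0 : ℝ) + ∑ j : Fin w, (c j.succ : ℝ) *
      DilogPade.polylogSeries ((j : ℕ) + 1) (1 / (N : ℝ)) = 0) :
    c = 0 := by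
  obtain ⟨k, rfl⟩ : ∃ k, w = k + 1 := ⟨w - 1, by omega⟩
  -- `N ≥ 4`, `x = 1/N ∈ (0, 1/2]`
  have hwr : (1 : ℝ) ≤ ((k + 1 : ℕ) : ℝ) := by exact_mod_cast hw
  have hL3 : (8 : ℝ) ≤ Real.log N := by
    have h2 : (2 : ℝ) ≤ ((k + 1 : ℕ) : ℝ) + 1 := by linarith
    calc (8 : ℝ) = 2 ^ 3 := by norm_num
      _ ≤ (((k + 1 : ℕ) : ℝ) + 1) ^ 3 := pow_le_pow_left₀ (by norm_num) h2 3
      _ ≤ Real.log N := hN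
  have hN0 : (N : ℝ) ≠ 0 := by
    intro h0; rw [h0, Real.log_zero] at hL3; linarith
  have hNpos : (0 : ℝ) < N := lt_of_le_of_ne (Nat.cast_nonneg N) (Ne.symm hN0)
  have hN4 : (4 : ℝ) ≤ N := by
    have h1 : Real.log N ≤ (N : ℝ) - 1 := Real.log_le_sub_one_of_pos hNpos
    linarith
  have hN2 : 2 ≤ N := by exact_mod_cast (show (2 : ℝ) ≤ N by linarith)
  have hN1 : 1 ≤ N := le_trans (by norm_num) hN2
  have hx0 : (0 : ℝ) < 1 / N := by positivity
  have hx1 : 1 / (N : ℝ) ≤ 1 / 2 := one_div_le_one_div_of_le (by norm_num) (by linarith)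
  have hx1' : 1 / (N : ℝ) < 1 := by linarith
  -- the numbers `θ_j = L_{j+1}`
  set θ : Fin (k + 1) → ℝ := fun j => DilogPade.polylogSeries ((j : ℕ) + 1) (1 / (N : ℝ)) with hθ
  have h' : (c 0 : ℝ) + ∑ j : Fin (k + 1), (c j.succ : ℝ) * θ j = 0 := by simpa [hθ] using h
  -- the partial-fraction data of the kernels, and the integer forms
  choose cf hcf using fun n => exists_pf_kernelW (k + 1) n hw
  have hev : ∀ n (u : ℕ), kernelW (k + 1) n u = BallRivoal.pfEval n (k + 1) (cf n) u := by
    intro n u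
    refine ((hcf n).1 u fun m _ => ?_).symm
    have : (0 : ℚ) < (u : ℚ) + m + 1 := by positivity
    exact this.ne'
  have hint : ∀ n, BallRivoal.IsInt (k + 1) (Nat.lcmUpto n) (cf n) := fun n => (hcf n).2.1
  have hl1 : ∀ n, BallRivoal.l1 n (k + 1) (cf n) ≤ ((k + 1).factorial : ℚ) *
      ∏ s ∈ range (k + 1), ((2 : ℚ) ^ n * ((n * (s + 2)).choose n : ℚ)) := fun n => (hcf n).2.2
  choose q hq using fun n (j : Fin (k + 1)) =>
    isInt_lcmUpto_pow_mul_coefW (hint n) N (o := (j : ℕ)) j.isLt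
  choose p hp using fun n => isInt_lcmUpto_pow_mul_constW (hint n) hN1 (w := k + 1)
  set D : ℕ → ℝ := fun n => ((Nat.lcmUpto n : ℝ)) ^ (k + 1) with hD
  have hDpos : ∀ n, 0 < D n := fun n => by
    simp only [hD]; exact pow_pos (by exact_mod_cast Nat.lcmUpto_pos n) _
  have hD1 : ∀ n, 1 ≤ D n := fun n => by
    simp only [hD]; exact one_le_pow₀ (by exact_mod_cast Nat.lcmUpto_pos n)
  have hqR : ∀ n (j : Fin (k + 1)), (q n j : ℝ) = D n * ((coefW n (cf n) N j : ℚ) : ℝ) := by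
    intro n j
    have h1 := congrArg (fun t : ℚ => (t : ℝ)) (hq n j)
    push_cast at h1
    simp only [hD]
    linarith
  have hpR : ∀ n, (p n : ℝ) = D n * ((constW n (k + 1) (cf n) N : ℚ) : ℝ) := by
    intro n
    have h1 := congrArg (fun t : ℚ => (t : ℝ)) (hp n)
    push_cast at h1
    simp only [hD]
    linarith
  -- the value of the forms
  have hval : ∀ n, (p n : ℝ) + ∑ j, (q n j : ℝ) * θ j = D n * formW (k + 1) n (1 / (N : ℝ)) := by
    intro n
    rw [formW_eq_of_pfEval hN2 (cf n) (hev n), hpR, mul_add, mul_sum, Finset.sum_range, add_comm]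
    congr 1
    refine Finset.sum_congr rfl fun j _ => ?_
    rw [hqR n j]
    simp only [hθ]
    ring
  have hform_pos : ∀ n, 0 < formW (k + 1) n (1 / (N : ℝ)) := fun n => formW_pos _ n hx0 hx1'
  have hℓpos : ∀ n, 0 < D n * formW (k + 1) n (1 / (N : ℝ)) := fun n =>
    mul_pos (hDpos n) (hform_pos n)
  -- the constants (opaque, with defining equations, for `linarith`)
  obtain ⟨wr, hwrdef⟩ : ∃ wr : ℝ, wr = ((k + 1 : ℕ) : ℝ) := ⟨_, rfl⟩
  obtain ⟨l2, hl2def⟩ : ∃ l2 : ℝ, l2 = Real.log 2 := ⟨_, rfl⟩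
  obtain ⟨L, hLdef⟩ : ∃ L : ℝ, L = Real.log N := ⟨_, rfl⟩
  obtain ⟨κ, hκdef⟩ : ∃ κ : ℝ, κ = wr * (wr + 1) * Real.log ((wr + 1) / wr) := ⟨_, rfl⟩
  obtain ⟨cw, hcwdef⟩ : ∃ cw : ℝ, cw = wr * (wr + 2) * l2 := ⟨_, rfl⟩
  obtain ⟨δ, hδdef⟩ : ∃ δ : ℝ, δ = 1 / 8 := ⟨_, rfl⟩
  have hwr1 : 1 ≤ wr := by rw [hwrdef]; exact hwr
  have hwrk : wr = (k : ℝ) + 1 := by rw [hwrdef]; push_cast; ring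
  have hδ : (0 : ℝ) < δ := by rw [hδdef]; norm_num
  have hl2 : 0.6931471803 < l2 := by rw [hl2def]; exact Real.log_two_gt_d9
  have hl2' : l2 < 0.6931471808 := by rw [hl2def]; exact Real.log_two_lt_d9
  have hL : (wr + 1) ^ 3 ≤ L := by rw [hLdef, hwrdef]; exact hN
  have hκ0 : 0 ≤ κ := by
    rw [hκdef]
    refine mul_nonneg (by positivity) (Real.log_nonneg ?_)
    rw [le_div_iff₀ (by linarith)]; linarith
  have hκ1 : κ ≤ wr + 1 := by
    rw [hκdef]
    have h1 : Real.log ((wr + 1) / wr) ≤ (wr + 1) / wr - 1 := Real.log_le_sub_one_of_pos (by positivity)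
    have h2 : (wr + 1) / wr - 1 = 1 / wr := by field_simp; ring
    rw [h2] at h1
    calc wr * (wr + 1) * Real.log ((wr + 1) / wr) ≤ wr * (wr + 1) * (1 / wr) :=
          mul_le_mul_of_nonneg_left h1 (by positivity)
      _ = wr + 1 := by field_simp
  have hcw0 : 0 ≤ cw := by rw [hcwdef]; positivity
  have hcw1 : cw ≤ 0.7 * wr * (wr + 2) := by rw [hcwdef]; nlinarith
  have hLpos : 0 < L := by nlinarith
  -- powers as exponentials in the opaque constants
  have hxpow : ∀ m : ℕ, (1 / (N : ℝ)) ^ m = Real.exp (-(L * m)) := fun m => by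
    rw [hLdef]; exact DilogPade.one_div_pow_eq_exp hNpos m
  have hNpow : ∀ m : ℕ, (N : ℝ) ^ m = Real.exp (L * m) := fun m => by
    rw [hLdef]; exact DilogPade.pow_eq_exp_log_mul hNpos m
  have h2pow : ∀ m : ℕ, (2 : ℝ) ^ m = Real.exp (l2 * m) := fun m => by
    rw [hl2def]; exact DilogPade.pow_eq_exp_log_mul two_pos m
  -- the gap inequalities
  obtain ⟨g0, g1, g2⟩ := gap_inequalities hwr1 hδdef hκ0 hκ1 hcw0 hcw1 hL
  have hk : (k : ℝ) = wr - 1 := by linarith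
  -- apply the reduction + transference with
  -- `A₁ = wL + κ + 2δ`, `A₂ = wL − w − δ`, `B = L + cw + w + 2δ`
  refine relation_trivial_of_small_forms (k := k)
    (fun ξ A₁ A₂ B h1 h2 h3 h4 h5 P Q hl hu hQ => no_integer_forms ξ h1 h2 h3 h4 h5 P Q hl hu hQ)
    θ (A₁ := wr * L + κ + 2 * δ) (A₂ := wr * L - wr - δ) (B := L + cw + wr + 2 * δ)
    ?_ ?_ ?_ ?_ ?_ p q ?_ ?_ ?_ c h'
  · -- `0 < A₂`
    exact g0
  · -- `A₂ ≤ A₁`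
    linarith
  · -- `0 ≤ B`
    linarith
  · -- `k B < A₂`
    rw [hk]; exact g1
  · -- `k (A₁ + B) < (k + 1) A₂`
    rw [hk]; exact g2
  · -- lower bound `e^{-A₁ n} ≤ ℓ_n`
    have hfac' := eventually_exp_le_factorial_pow_ratio (k + 1) hw hδ
    have hκ' : ((k + 1 : ℕ) : ℝ) * ((k + 1 : ℕ) + 1) *
        Real.log ((((k + 1 : ℕ) : ℝ) + 1) / ((k + 1 : ℕ) : ℝ)) = κ := by rw [hκdef, hwrdef]
    filter_upwards [hfac', DilogPade.eventually_const_le_mul L hδ] with n hfac hLn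
    rw [hval n, abs_of_pos (hℓpos n)]
    have hfac2 : Real.exp (-((κ + δ) * n)) ≤
        (((k + 1) * n).factorial : ℝ) ^ (k + 1 + 1) / ((((k + 1 + 1) * n + 1).factorial : ℝ) ^ (k + 1)) := by
      have := hfac
      rw [hκ'] at this
      convert this using 2
    calc Real.exp (-((wr * L + κ + 2 * δ) * n))
        ≤ Real.exp (-((κ + δ) * n)) * Real.exp (-(L * (((k + 1) * n + 1 : ℕ) : ℝ))) := by
          rw [← Real.exp_add]
          apply Real.exp_le_exp.2
          rw [hwrk]
          push_cast
          linear_combination hLn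
      _ ≤ (((k + 1) * n).factorial : ℝ) ^ (k + 1 + 1) /
            ((((k + 1 + 1) * n + 1).factorial : ℝ) ^ (k + 1)) * (1 / (N : ℝ)) ^ ((k + 1) * n + 1) := by
          rw [hxpow]
          exact mul_le_mul_of_nonneg_right hfac2 (Real.exp_pos _).le
      _ ≤ formW (k + 1) n (1 / (N : ℝ)) := formW_ge _ n hx0.le hx1'
      _ ≤ D n * formW (k + 1) n (1 / (N : ℝ)) := le_mul_of_one_le_left (hform_pos n).le (hD1 n)
  · -- upper bound `ℓ_n ≤ e^{-A₂ n}`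
    have hDev := Literature.NumberTheory.Transcendental.eventually_lcmUpto_mul_pow_le_exp 1 (k + 1) hδ
    filter_upwards [hDev] with n hDn
    rw [one_mul] at hDn
    push_cast at hDn
    rw [hval n, abs_of_pos (hℓpos n)]
    have hform_le : formW (k + 1) n (1 / (N : ℝ)) ≤ (1 / (N : ℝ)) ^ ((k + 1) * n) :=
      formW_le _ n hx0.le hx1
    calc D n * formW (k + 1) n (1 / (N : ℝ))
        ≤ Real.exp ((1 * ((k : ℝ) + 1) + δ) * n) * Real.exp (-(L * (((k + 1) * n : ℕ) : ℝ))) := by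
          refine mul_le_mul ?_ ?_ (hform_pos n).le (Real.exp_pos _).le
          · simp only [hD]; exact_mod_cast hDn
          · rw [← hxpow]; exact hform_le
      _ = Real.exp (-((wr * L - wr - δ) * n)) := by
          rw [← Real.exp_add]
          congr 1
          rw [hwrk]
          push_cast
          ring
  · -- coefficients `|q_{n,j}| ≤ e^{B n}`
    have hDev := Literature.NumberTheory.Transcendental.eventually_lcmUpto_mul_pow_le_exp 1 (k + 1) hδ
    filter_upwards [hDev, DilogPade.eventually_const_le_exp_mul (((k + 1).factorial : ℝ)) hδ]
      with n hDn hfact j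
    rw [one_mul] at hDn
    push_cast at hDn
    have hDle : D n ≤ Real.exp ((((k : ℝ) + 1) + δ) * n) := by
      simp only [hD]
      have := hDn
      simp only [one_mul] at this
      exact_mod_cast this
    -- the size of the coefficient over `ℚ`
    have hco : |((coefW n (cf n) N j : ℚ) : ℝ)| ≤
        ((k + 1).factorial : ℝ) * (2 : ℝ) ^ (n * ((k + 1) * (k + 3))) * (N : ℝ) ^ n := by
      have h1 : |coefW n (cf n) N j| ≤ BallRivoal.l1 n (k + 1) (cf n) * (N : ℚ) ^ n :=
        abs_coefW_le (cf n) hN1 j.isLt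
      have h2 : BallRivoal.l1 n (k + 1) (cf n) ≤
          ((k + 1).factorial : ℚ) * (2 : ℚ) ^ (n * ((k + 1) * (k + 3))) := by
        refine (hl1 n).trans (mul_le_mul_of_nonneg_left ?_ (by positivity))
        refine (prod_two_pow_mul_choose_le (k + 1) n).trans ?_
        calc ∏ s ∈ range (k + 1), (2 : ℚ) ^ (n * (s + 3))
            ≤ ∏ _s ∈ range (k + 1), (2 : ℚ) ^ (n * (k + 3)) := by
              refine prod_le_prod (fun s _ => by positivity) fun s hs => ?_
              exact pow_le_pow_right₀ (by norm_num)
                (Nat.mul_le_mul_left n (by have := mem_range.1 hs; omega))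
          _ = (2 : ℚ) ^ (n * ((k + 1) * (k + 3))) := by
              rw [prod_const, card_range, ← pow_mul]; ring_nf
      have h3 : |coefW n (cf n) N j| ≤
          ((k + 1).factorial : ℚ) * (2 : ℚ) ^ (n * ((k + 1) * (k + 3))) * (N : ℚ) ^ n :=
        h1.trans (mul_le_mul_of_nonneg_right h2 (by positivity))
      have h4 := (Rat.cast_le (K := ℝ)).2 h3
      push_cast at h4
      exact h4
    rw [hqR n j, abs_mul, abs_of_pos (hDpos n)]
    calc D n * |((coefW n (cf n) N j : ℚ) : ℝ)|
        ≤ Real.exp ((((k : ℝ) + 1) + δ) * n) *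
            (((k + 1).factorial : ℝ) * (2 : ℝ) ^ (n * ((k + 1) * (k + 3))) * (N : ℝ) ^ n) :=
          mul_le_mul hDle hco (abs_nonneg _) (Real.exp_pos _).le
      _ ≤ Real.exp ((((k : ℝ) + 1) + δ) * n) *
            (Real.exp (δ * n) * (2 : ℝ) ^ (n * ((k + 1) * (k + 3))) * (N : ℝ) ^ n) := by
          refine mul_le_mul_of_nonneg_left ?_ (Real.exp_pos _).le
          exact mul_le_mul_of_nonneg_right (mul_le_mul_of_nonneg_right hfact (by positivity))
            (by positivity)
      _ = Real.exp ((L + cw + wr + 2 * δ) * n) := by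
          rw [h2pow, hNpow, ← Real.exp_add, ← Real.exp_add, ← Real.exp_add]
          congr 1
          rw [hcwdef, hwrk]
          push_cast
          ring

end PolylogPade

open PolylogPade in
/-- **Linear independence of `1, Li₁(1/N), …, Li_w(1/N)` over `ℚ`** for `w ≥ 1` and
`log N ≥ (w+1)³`: every rational relation `a₀ + ∑_{j<w} a_{j+1} L_{j+1} = 0`
(`L_s = DilogPade.polylogSeries s (1/N) = Li_s(1/N)`) is trivial. Nikišin 1979 / Hata 1990 /
David–Hirata-Kohno–Kawashima 2020, Thm 2.1, with a crude threshold.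
[cite: DavidHirataKohnoKawashima2020, Thm 2.1] -/
theorem one_polylog_linearIndependent (w : ℕ) (hw : 1 ≤ w) (N : ℕ)
    (hN : ((w : ℝ) + 1) ^ 3 ≤ Real.log N) (a : Fin (w + 1) → ℚ)
    (h : (a 0 : ℝ) + ∑ j : Fin w, (a j.succ : ℝ) *
      DilogPade.polylogSeries ((j : ℕ) + 1) (1 / (N : ℝ)) = 0) :
    a = 0 := by
  classical
  -- a common denominator and the integer coefficients `c i = d · a i`
  set d : ℕ := ∏ i, (a i).den with hd
  have hdpos : 0 < d := Finset.prod_pos fun i _ => (a i).den_pos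
  have hcex : ∀ i, ∃ z : ℤ, (d : ℚ) * a i = z := by
    intro i
    obtain ⟨e, he⟩ : (a i).den ∣ d := Finset.dvd_prod_of_mem (fun i => (a i).den) (mem_univ i)
    refine ⟨(e : ℤ) * (a i).num, ?_⟩
    have h1 : (d : ℚ) = ((a i).den : ℚ) * e := by exact_mod_cast he
    rw [h1, mul_comm ((a i).den : ℚ), mul_assoc, Rat.den_mul_eq_num]
    push_cast
    ring
  choose c hc using hcex
  have hcR : ∀ i, (c i : ℝ) = (d : ℝ) * a i := fun i => by
    have := congrArg (fun t : ℚ => (t : ℝ)) (hc i)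
    push_cast at this
    linarith
  have hrel : (c 0 : ℝ) + ∑ j : Fin w, (c j.succ : ℝ) *
      DilogPade.polylogSeries ((j : ℕ) + 1) (1 / (N : ℝ)) = 0 := by
    have := congrArg (fun t => (d : ℝ) * t) h
    simp only [mul_zero, mul_add, Finset.mul_sum] at this
    rw [hcR]
    convert this using 2
    refine Finset.sum_congr rfl fun j _ => ?_
    rw [hcR]; ring
  have hc0 := PolylogPade.intRelation_trivial w hw N hN c hrel
  funext i
  have h1 : (d : ℚ) * a i = 0 := by rw [hc i, hc0]; simp
  have hd0 : (d : ℚ) ≠ 0 := by exact_mod_cast hdpos.ne'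
  simpa [hd0] using h1

end Literature.NumberTheory.DiophantineApproximation
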